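import Literature.IUT.HodgeTheaters.PMBaseStrips
import Literature.IUT.HodgeTheaters.PMBaseKitModel
import HarnessLib

/-!
# [IUTchI] Def 6.1 (iv) «precisely two `+`-full poly-isomorphisms» (`PMBaseKit.PreciselyTwoPlusFullPolyAut`) is a SCHEMA over the
# frozen base interface `PMBaseKit` — universal-closure certificate, binder-free (proof-only)

S. Mochizuki, *Inter-universal Teichmüller theory I: construction of Hodge theaters*, kurims manuscript (May 2020), Def 6.1 (iv)
p. 157 («In particular, if `†𝔇 = ‡𝔇`, then there are precisely two `+`-full poly-isomorphisms `†𝒟_v ⥲ ‡𝒟_v` … the unique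
non-positive `+`-full poly-isomorphism, which we shall refer to as negative») [claim: Mochizuki2012, status: disputed] (D-0012 claim
key; series status DISPUTED — kernel theorems about abc-iut-L5-t4's INTERFACE `PMBaseKit` (`PMBaseStrips`) and its consistency model
`toyKit` (`PMBaseKitModel`); nothing of the series is asserted, no side is taken on [IUTchIII] Cor. 3.12).

abc-iut cell, FACT-LIST row **F-2039** (`PMBaseKit.PreciselyTwoPlusFullPolyAut`, `PMBaseStrips.lean`), layer L5, lane «KL5-CLOSURE-CERTS»
(abc-iut-w6-d089 g5 04:09:25Z: «left: … F-2039 … closure side needs a custom PMBaseKit … with a non-local object — not taken»;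
`plan/LF-KERNEL-STATUS.tsv` 04:10Z: class «?», conditional closer `preciselyTwoPlusFullPolyAut (hX : K.IsLocal v X)` only); seat
abc-iut-L5-t13 gen 8.  PROOF-ONLY, nothing re-typed, no `def`.

No custom kit is needed: abc-iut-L5-t4's consistency model `toyKit l hl` ALREADY carries a non-local object.  Its ambient category at
the one place is the collage category `Model.Obj l` with objects `loc` (the model `𝒟_v`) and `glob` (the model `𝒟^{⊚±}` seen at `v`),
`Hom(glob, loc) = ∅`, `Aut(glob) = AGL₁(𝔽_l)` acting on `LabCusp^± = 𝔽_l` affinely.  At `glob` the positive automorphisms are the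
identity alone, so EVERY `+`-full poly-automorphism is a singleton, while the negative automorphisms (those moving label classes) are
all of `AGL₁(𝔽_l) ∖ {1}` — at least the two translations `z ↦ z ± 1` (distinct for `l ≠ 2`): «the» negative `+`-full
poly-automorphism is not ONE `Aut₊`-orbit, and clause two of `PreciselyTwoPlusFullPolyAut` fails.  In the grammar of
`PuncturedEllipticCoveringsRmk121ClosureCertificate` (`exists_not_…` / `not_forall_…` / `…_schema`):
* `not_preciselyTwoPlusFullPolyAut_of_two_negatives` — WHICH DEGENERATION KILLS THE CLAUSE (any kit): two automorphisms acting on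
  `LabCusp^±(†𝒟_v)` nontrivially AND differently falsify `PreciselyTwoPlusFullPolyAut v X` (both would lie in the single `Aut₊`-orbit
  `negativePolyAut`, hence act alike);
* `not_preciselyTwoPlusFullPolyAut_toyKit_glob (hl : l ≠ 2)` — at the non-local object `glob` of `toyKit l hl` (translations by `±1`);
* `exists_not_preciselyTwoPlusFullPolyAut`, `not_forall_preciselyTwoPlusFullPolyAut` — **F-2039's universal closure over the interface
  is FALSE**, no binder (`l = 3`, Mathlib `Nat.fact_prime_three`);
* `exists_preciselyTwoPlusFullPolyAut`, `preciselyTwoPlusFullPolyAut_schema` — and CONSISTENT, no binder (the model object `loc` of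
  `toyKit 3`, abc-iut-L5-t4's `preciselyTwoPlusFullPolyAut` at `isLocal_model`): **F-2039 is a SCHEMA**; its content is the conditional
  closer under `IsLocal` («if `†𝔇 = ‡𝔇`» — print speaks of isomorphs of `𝒟_v` only), which fires at every object of every `𝒟`-strip
  (`DStrip.preciselyTwoPlusFullPolyAut_obj`) and at the genuine kits (`preciselyTwoPlusFullPolyAut_baseKitThetaNF*`).
HONEST FRAMING: a refuted universal closure is a statement about OUR typing (the predicate is stated for every object of the ambient
category, print's sentence only for isomorphs `†𝒟_v` of `𝒟_v`), not about Def 6.1 (iv) in print; refuted-as-typed ≠ refuted-in-print;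
typed ≠ proved; nothing here bears on [IUTchIII] Cor. 3.12 or asserts anything about abc.
-/

namespace Literature.IUT.HodgeTheaters

namespace PMBaseKit

open CategoryTheory

universe u

/-! ## Which degeneration kills the clause -/

/-- **Two distinct negative actions falsify «precisely two `+`-full poly-automorphisms»** (any kit, any object): if `ψ₁`, `ψ₂ ∈ Aut(X)`
both act nontrivially on `LabCusp^±(X)` and act DIFFERENTLY, then `PreciselyTwoPlusFullPolyAut v X` fails — its second clause makes the
set of negative automorphisms a single `Aut₊(X)`-orbit `{φ ≪≫ a | a ∈ Aut₊}`, all of whose members act on label classes as `φ` does.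
([IUTchI] Def 6.1 (iv) p.157) [claim: Mochizuki2012, status: disputed] -/
theorem not_preciselyTwoPlusFullPolyAut_of_two_negatives {l : ℕ} (K : PMBaseKit.{u} l) (v : K.V) (X : K.Amb v)
    (ψ₁ ψ₂ : X ≅ X) (h₁ : K.labMap v ψ₁ ≠ Equiv.refl _) (h₂ : K.labMap v ψ₂ ≠ Equiv.refl _)
    (h₁₂ : K.labMap v ψ₁ ≠ K.labMap v ψ₂) : ¬ K.PreciselyTwoPlusFullPolyAut v X := by
  rintro ⟨-, ⟨φ, hφ⟩, -⟩
  have hm₁ : ψ₁ ∈ K.negativePolyAut v X := h₁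
  have hm₂ : ψ₂ ∈ K.negativePolyAut v X := h₂
  rw [hφ] at hm₁ hm₂
  obtain ⟨a₁, ha₁, e₁⟩ := hm₁
  obtain ⟨a₂, ha₂, e₂⟩ := hm₂
  rw [K.mem_autPlus_iff] at ha₁ ha₂
  apply h₁₂
  rw [e₁, e₂, K.labMap_trans, K.labMap_trans, ha₁, ha₂]

/-! ## The non-local object `glob` of the consistency model -/

/-- **At the non-local object `glob` of abc-iut-L5-t4's `toyKit l hl`** (`Aut(glob) = AGL₁(𝔽_l)` acting affinely on `LabCusp^± = 𝔽_l`):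
the translations `z ↦ z + 1` and `z ↦ z − 1` are automorphisms acting nontrivially and (as `l ≠ 2`) differently on label classes, so
`PreciselyTwoPlusFullPolyAut () glob` FAILS. ([IUTchI] Def 6.1 (iv) p.157) [claim: Mochizuki2012, status: disputed] -/
theorem not_preciselyTwoPlusFullPolyAut_toyKit_glob (l : ℕ) [Fact l.Prime] (hl : l ≠ 2) :
    ¬ (toyKit l hl).PreciselyTwoPlusFullPolyAut () Model.Obj.glob := by
  -- automorphisms of `glob` from elements of `AGL₁(𝔽_l)`
  let ι : Model.AGL l → ((Model.Obj.glob : (toyKit l hl).Amb ()) ≅ Model.Obj.glob) := fun g =>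
    { hom := g
      inv := (g⁻¹ : Model.AGL l)
      hom_inv_id := by
        change (g⁻¹ : Model.AGL l) * g = 1
        exact inv_mul_cancel g
      inv_hom_id := by
        change g * (g⁻¹ : Model.AGL l) = 1
        exact mul_inv_cancel g }
  -- the translation by `b`, acting on label classes `𝔽_l` as `z ↦ z + b`
  let τ : ZMod l → Model.AGL l := fun b => ⟨Multiplicative.ofAdd b, 1⟩
  have hτ : ∀ b z : ZMod l, (toyKit l hl).labMap () (ι (τ b)) z = z + b := fun b z => by
    change ((1 : (ZMod l)ˣ) : ZMod l) * z + (Multiplicative.ofAdd b).toAdd = z + b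
    simp
  refine not_preciselyTwoPlusFullPolyAut_of_two_negatives (toyKit l hl) () Model.Obj.glob (ι (τ 1)) (ι (τ (-1)))
    (fun h => ?_) (fun h => ?_) (fun h => ?_)
  · have h1 : (toyKit l hl).labMap () (ι (τ 1)) (0 : ZMod l) = (0 : ZMod l) := by rw [h]; rfl
    rw [hτ, zero_add] at h1
    have h1' : (1 : ZMod l) = 0 := h1
    exact one_ne_zero h1'
  · have h1 : (toyKit l hl).labMap () (ι (τ (-1))) (0 : ZMod l) = (0 : ZMod l) := by rw [h]; rfl
    rw [hτ, zero_add] at h1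
    have h1' : (-1 : ZMod l) = 0 := h1
    rw [neg_eq_zero] at h1'
    exact one_ne_zero h1'
  · have h1 : (toyKit l hl).labMap () (ι (τ 1)) (0 : ZMod l) = (toyKit l hl).labMap () (ι (τ (-1))) (0 : ZMod l) := by
      rw [h]
    rw [hτ, hτ, zero_add, zero_add] at h1
    have h1' : (-1 : ZMod l) = 1 := h1.symm
    have h2 : ringChar (ZMod l) = 2 := neg_one_eq_one_iff.mp h1'
    rw [ZMod.ringChar_zmod_n] at h2
    exact hl h2

/-! ## F-2039 `PreciselyTwoPlusFullPolyAut`: consistent ∧ independent, binder-free -/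

/-- **F-2039, refuting instance with no binder**: a prime `l` (namely `3`), a kit, a place and an object of the ambient category there
(the non-local `glob` of `toyKit 3`) at which «precisely two `+`-full poly-automorphisms» FAILS.
([IUTchI] Def 6.1 (iv) p.157) [claim: Mochizuki2012, status: disputed] -/
theorem exists_not_preciselyTwoPlusFullPolyAut :
    ∃ (l : ℕ) (_ : Fact l.Prime) (K : PMBaseKit.{0} l) (v : K.V) (X : K.Amb v), ¬ K.PreciselyTwoPlusFullPolyAut v X := by
  haveI : Fact (Nat.Prime 3) := Nat.fact_prime_three
  exact ⟨3, inferInstance, toyKit 3 (by decide), (), Model.Obj.glob, not_preciselyTwoPlusFullPolyAut_toyKit_glob 3 (by decide)⟩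

/-- **F-2039: the universal closure of `PreciselyTwoPlusFullPolyAut` over the interface is FALSE** (the predicate is typed for every
object of the ambient category; print's sentence is about isomorphs of `𝒟_v`).
([IUTchI] Def 6.1 (iv) p.157) [claim: Mochizuki2012, status: disputed] -/
theorem not_forall_preciselyTwoPlusFullPolyAut :
    ¬ ∀ (l : ℕ) (_ : Fact l.Prime) (K : PMBaseKit.{0} l) (v : K.V) (X : K.Amb v), K.PreciselyTwoPlusFullPolyAut v X := fun h => by
  obtain ⟨l, hl, K, v, X, hX⟩ := exists_not_preciselyTwoPlusFullPolyAut
  exact hX (h l hl K v X)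

/-- **F-2039, satisfying instance with no binder**: at the model object `loc = 𝒟_v` of `toyKit 3` the clause HOLDS (abc-iut-L5-t4's
conditional closer `preciselyTwoPlusFullPolyAut` at `isLocal_model`). ([IUTchI] Def 6.1 (iv) p.157) [claim: Mochizuki2012, status: disputed] -/
theorem exists_preciselyTwoPlusFullPolyAut :
    ∃ (l : ℕ) (_ : Fact l.Prime) (K : PMBaseKit.{0} l) (v : K.V) (X : K.Amb v), K.PreciselyTwoPlusFullPolyAut v X := by
  haveI : Fact (Nat.Prime 3) := Nat.fact_prime_three
  exact ⟨3, inferInstance, toyKit 3 (by decide), (), (toyKit 3 (by decide)).model (),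
    preciselyTwoPlusFullPolyAut ((toyKit 3 (by decide)).isLocal_model ())⟩

/-- **F-2039 is a SCHEMA** (consistent ∧ independent over the interface, binder-free); its content is the conditional closer
`preciselyTwoPlusFullPolyAut (hX : K.IsLocal v X)`, firing at every object of every `𝒟`-strip and at the genuine kits.
([IUTchI] Def 6.1 (iv) p.157) [claim: Mochizuki2012, status: disputed] -/
theorem preciselyTwoPlusFullPolyAut_schema :
    (∃ (l : ℕ) (_ : Fact l.Prime) (K : PMBaseKit.{0} l) (v : K.V) (X : K.Amb v), K.PreciselyTwoPlusFullPolyAut v X) ∧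
      ∃ (l : ℕ) (_ : Fact l.Prime) (K : PMBaseKit.{0} l) (v : K.V) (X : K.Amb v), ¬ K.PreciselyTwoPlusFullPolyAut v X :=
  ⟨exists_preciselyTwoPlusFullPolyAut, exists_not_preciselyTwoPlusFullPolyAut⟩

end PMBaseKit

end Literature.IUT.HodgeTheaters
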